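import Summits.PneNP.PneNP.Theses.RootDecompSpaceCeiling
import Literature.Computability.Complexity.AvgPRel
import Literature.Computability.Complexity.BPPSubsetAlmostP
import Literature.Computability.Complexity.CountingHierarchy
import Literature.Computability.Complexity.CountingHierarchyProofs
import Literature.Computability.Complexity.StringCopy
import Literature.Computability.Complexity.StringEquality
import Literature.Computability.Complexity.PRelHierarchy
import Literature.Computability.Complexity.ReductionsProofs
import Literature.Computability.Complexity.OracleEmpty
import Literature.Computability.Complexity.OracleProofs
import Literature.Computability.Complexity.SigmaPRelClosure
import Mathlib.Analysis.SpecificLimits.Normed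

/-!
# `RootDecompSpaceCeiling.CollapseLift` (stmt-PneNP-23703) — the PADDING LAW: the hub residual K is invariant under average-case relaxation of its lift side

Support file (S-free; it closes no item and defines no proposition) for the hub residual of the
decomp-pnenp root-decomposition cell, `K = RootDecompSpaceCeiling.CollapseLift := NP ⊆ P → PP ⊆ P`
(route `route-PneNP-RootDecompSpaceCeiling`). Port of the lens-4 g17 kernel «HeuristicDial»
(HOME/decomp-pnenp-lens-4/HeuristicDial.lean), restated over the route declaration BY NAME with the
lens's heuristic classes written out (no new notion: the tree's `errFraction` and `AvgPRel`).

CONTENT. For a language `L` let `Pad L := {z | copyFn (fstP z) = z ∧ fstP z ∈ L} = {⟨x,x⟩ | x ∈ L}`.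
§1 `Pad L` stays in every class closed under `FP`-preimages and meets with `P` (so in `PP`, `PP^O`), and
`copyFn ⁻¹' Pad L = L`. §2 `Pad L` has at most `2^((m-2)/3)` words of length `m`, so the constant answer
`false` errs on it with fraction `≤ 2^((m-2)/3)/2ᵐ → 0`: `Pad L ∈ AvgP^O` for EVERY `L` and every oracle
(Aaronson–Ambainis' heuristic class, tree `AvgPRel`). §3 THE PADDING LAW:
`K ⟺ (NP ⊆ P → PP ∩ AvgP ⊆ P)` (`collapseLift_iff_avgLift`), its relativization for every oracle
(`kRel_iff_avgLiftRel`), and the budgeted form `K ⟺ (NP ⊆ P → PP ∩ Heur_δ P ⊆ P)` for every DENSE error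
budget `δ` (`2^((m-2)/3) ≤ δ m · 2ᵐ` eventually — all constants, all inverse polynomials, `2^-(m/2)`;
`collapseLift_iff_heurLift`), while `K → (NP ⊆ P → PP ⊆ AvgP)` (`avgCatch_of_collapseLift`). Reading: no
uniform average-case relaxation of the target class splits K with a strictly weaker lift piece — padding makes
every `PP` language exponentially sparse, and sparse languages are heuristically trivial (LAW xxii of the cell,
«average-case exclusion»; honest negative of lens-4 g17).

[cite: AaronsonAmbainis2014, §1 (AvgP)] [cite: BogdanovTrevisan2006, Def. 2.13] [cite: BakerGillSolovay1975, Thm. 1]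
[cite: AroraBarak2009, §1.3 (copyFn), Thm. 2.8]
-/

namespace Summit.PneNP.PneNP.Theorems.RootDecompHeuristicPaddingPort

set_option linter.dupNamespace false -- `Summit.PneNP.PneNP.…`: summit = sub-problem name (D-0017 single-conjunct layout)

open Literature.Computability.Complexity _root_.Computability Filter
open Summit.PneNP.PneNP.Theses

/-! ## §0 small tree facts -/

/-- The empty language is in `P`. [cite: AroraBarak2009, Thm. 2.8] -/
theorem zero_mem_P : (0 : Language Bool) ∈ Classes.P := by
  have h := shortPart_mem_P (0 : Language Bool) 0
  have hE : ({x | x ∈ (0 : Language Bool) ∧ x.length < 0} : Language Bool) = (0 : Language Bool) :=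
    Language.ext fun x => ⟨fun hx => absurd hx.1 (Language.notMem_zero x),
      fun hx => absurd hx (Language.notMem_zero x)⟩
  rwa [hE] at h

/-- `∅ ∈ P^O`. [cite: BakerGillSolovay1975, Thm. 1] -/
theorem zero_mem_PRel (O : Oracle) : (0 : Language Bool) ∈ PRel O := P_subset_PRel_holds O zero_mem_P

/-- `[x ∈ ∅] = false`. [folklore] -/
theorem boolIndicator_zero (x : List Bool) : (0 : Language Bool).boolIndicator x = false :=
  (Set.notMem_iff_boolIndicator _ _).1 (Language.notMem_zero x)

/-- `fstP ⟨x,x⟩ = x`. [cite: AroraBarak2009, §1.3] -/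
theorem fstP_copyFn (x : List Bool) : fstP (copyFn x) = x := by
  rw [copyFn_apply, fstP_boolPair]

/-- `|⟨x,x⟩| = 3|x| + 2`. [cite: AroraBarak2009, §1.3] -/
theorem length_copyFn (x : List Bool) : (copyFn x).length = 3 * x.length + 2 := by
  rw [copyFn_apply, length_boolPair]; ring

/-- `PP^O` is closed under `FP`-preimages. [cite: BakerGillSolovay1975, Thm. 1] -/
theorem preimage_closed_PPRel (O : Oracle) :
    ∀ ⦃L : Language Bool⦄, L ∈ PPRel O → ∀ ⦃g : List Bool → List Bool⦄, g ∈ FP → g ⁻¹' L ∈ PPRel O :=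
  fun _ hL _ hg => preimage_mem_pMajority (fun _ hL' _ hg' => preimage_mem_PRel hL' hg') hL hg

/-- `P ⊆ PP^O`. [cite: BakerGillSolovay1975, Thm. 1] -/
theorem P_subset_PPRel (O : Oracle) : Classes.P ⊆ PPRel O := fun _ hL =>
  subset_pMajority_of_closed_fst (fun _ hL' => preimage_mem_PRel hL' fstP_mem_FP)
    (P_subset_PRel_holds O hL)

/-! ## §1 the padded language stays in the class, and unpadding is a Karp reduction -/

/-- `Pad L` lies in every class closed under `FP`-preimages and under meets with `P` languages.
[cite: AroraBarak2009, Thm. 2.8] -/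
theorem pad_mem_of_closed {K : Set (Language Bool)}
    (hK : ∀ ⦃L : Language Bool⦄, L ∈ K → ∀ ⦃g : List Bool → List Bool⦄, g ∈ FP → g ⁻¹' L ∈ K)
    (hPK : Classes.P ⊆ K) {L : Language Bool} (hL : L ∈ K) :
    ({z | copyFn (fstP z) = z ∧ fstP z ∈ L} : Language Bool) ∈ K := by
  have hE : ({z | copyFn (fstP z) = z ∧ fstP z ∈ L} : Language Bool) =
      ({z | (copyFn ∘ fstP) z = (fun w => w) z} : Language Bool) ⊓ (fstP ⁻¹' L) := rfl
  rw [hE]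
  exact inter_mem_of_preimage_closed hK hPK
    (setOf_apply_eq_apply_mem_P (comp_mem_FP copyFn_mem_FP fstP_mem_FP) (PolyTimeComputable.id _))
    (hK hL fstP_mem_FP)

/-- `Pad L ∈ PP` for `L ∈ PP`. [cite: AroraBarak2009, Thm. 2.8] -/
theorem pad_mem_PP {L : Language Bool} (hL : L ∈ PP) :
    ({z | copyFn (fstP z) = z ∧ fstP z ∈ L} : Language Bool) ∈ PP :=
  pad_mem_of_closed (K := PP) (fun _ hL _ hg => preimage_mem_PP hL hg) (P_subset_CkP 1) hL

/-- `Pad L ∈ PP^O` for `L ∈ PP^O`. [cite: BakerGillSolovay1975, Thm. 1] -/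
theorem pad_mem_PPRel {O : Oracle} {L : Language Bool} (hL : L ∈ PPRel O) :
    ({z | copyFn (fstP z) = z ∧ fstP z ∈ L} : Language Bool) ∈ PPRel O :=
  pad_mem_of_closed (preimage_closed_PPRel O) (P_subset_PPRel O) hL

/-- Unpadding: `copyFn ⁻¹' Pad L = L`. [cite: AroraBarak2009, §1.3] -/
theorem preimage_copyFn_pad (L : Language Bool) :
    copyFn ⁻¹' ({z | copyFn (fstP z) = z ∧ fstP z ∈ L} : Language Bool) = L := by
  -- NB: never unify the padded set against its preimage (the unifier would unfold `copyFn`).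
  ext x
  simp only [Set.mem_preimage, Set.mem_setOf_eq, fstP_copyFn, true_and]
  exact Iff.rfl

/-! ## §2 padded languages are exponentially sparse, hence heuristically trivial -/

/-- COUNTING CORE: any decidable family of length-`m` words all of the padded shape `⟨x,x⟩` has at
most `2^((m-2)/3)` members (unpadding `v ↦ fstP v` is injective on it and lands in `{0,1}^((m-2)/3)`).
The instance binder is implicit (taken by unification), so the lemma applies to `errFraction`'s own
filter verbatim. [folklore] -/
theorem card_filter_pad_le {m : ℕ} {p : List.Vector Bool m → Prop} {inst : DecidablePred p}
    (hp : ∀ v, p v → copyFn (fstP v.toList) = v.toList) :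
    (@Finset.filter _ p inst Finset.univ).card ≤ 2 ^ ((m - 2) / 3) := by
  set a := (m - 2) / 3 with ha
  set t : Finset (List Bool) := (Finset.univ : Finset (List.Vector Bool a)).image List.Vector.toList
    with ht
  have htc : t.card ≤ 2 ^ a :=
    (Finset.card_image_le).trans (by rw [Finset.card_univ, card_vector, Fintype.card_bool])
  refine le_trans (Finset.card_le_card_of_injOn (fun v => fstP v.toList) ?_ ?_) htc
  · intro v hv
    have hv' : copyFn (fstP v.toList) = v.toList := hp v (Finset.mem_filter.1 hv).2
    have hlen : (fstP v.toList).length = a := by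
      have h1 := congrArg List.length hv'
      rw [length_copyFn, v.toList_length] at h1
      omega
    exact Finset.mem_image.2 ⟨⟨fstP v.toList, hlen⟩, Finset.mem_univ _, rfl⟩
  · intro v hv w hw hvw
    have hv' : copyFn (fstP v.toList) = v.toList := hp v (Finset.mem_filter.1 hv).2
    have hw' : copyFn (fstP w.toList) = w.toList := hp w (Finset.mem_filter.1 hw).2
    apply List.Vector.toList_injective
    have e : fstP v.toList = fstP w.toList := hvw
    rw [← hv', ← hw', e]

open scoped Classical in
/-- In particular `Pad L` has at most `2^((m-2)/3)` words of length `m`: padded languages are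
exponentially SPARSE. [folklore] -/
theorem card_slice_pad_le (L : Language Bool) (m : ℕ) :
    (Finset.univ.filter fun v : List.Vector Bool m =>
      v.toList ∈ ({z | copyFn (fstP z) = z ∧ fstP z ∈ L} : Language Bool)).card ≤ 2 ^ ((m - 2) / 3) :=
  card_filter_pad_le fun _ hv => hv.1

/-- The empty heuristic (constant answer `false`) errs on `Pad L` with fraction `≤ 2^((m-2)/3) / 2ᵐ`:
its errors at length `m` are exactly the words of `Pad L`. [cite: BogdanovTrevisan2006, Def. 2.13] -/
theorem errFraction_pad_le (L : Language Bool) (m : ℕ) :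
    errFraction ({z | copyFn (fstP z) = z ∧ fstP z ∈ L} : Language Bool)
      (fun x => some ((0 : Language Bool).boolIndicator x)) m ≤ (2 : ℝ) ^ ((m - 2) / 3) / 2 ^ m := by
  unfold errFraction
  refine div_le_div_of_nonneg_right ?_ (by positivity)
  have hc := card_filter_pad_le (m := m)
    (p := fun x : List.Vector Bool m => (fun y => some ((0 : Language Bool).boolIndicator y)) x.toList ≠
      some (Set.boolIndicator ({z | copyFn (fstP z) = z ∧ fstP z ∈ L} : Language Bool) x.toList))
    (inst := inferInstance) fun v hv => by
      by_contra hne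
      apply hv
      have hnot : v.toList ∉ ({z | copyFn (fstP z) = z ∧ fstP z ∈ L} : Language Bool) := fun hm => hne hm.1
      show some ((0 : Language Bool).boolIndicator v.toList) = _
      rw [boolIndicator_zero, (Set.notMem_iff_boolIndicator _ _).1 hnot]
  exact_mod_cast hc

/-- `2^((m-2)/3) / 2ᵐ → 0`. [folklore] -/
theorem tendsto_pad_bound : Tendsto (fun m : ℕ => (2 : ℝ) ^ ((m - 2) / 3) / 2 ^ m) atTop (nhds 0) := by
  have h2 : Tendsto (fun k : ℕ => ((2 : ℝ)⁻¹) ^ k) atTop (nhds 0) :=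
    tendsto_pow_atTop_nhds_zero_of_lt_one (by norm_num) (by norm_num)
  have hdiv : Tendsto (fun m : ℕ => m - (m - 2) / 3) atTop atTop :=
    Filter.tendsto_atTop_atTop.2 fun b => ⟨3 * b, fun a ha => by omega⟩
  refine (h2.comp hdiv).congr fun m => ?_
  have hsplit : (2 : ℝ) ^ m = 2 ^ ((m - 2) / 3) * 2 ^ (m - (m - 2) / 3) := by
    rw [← pow_add]; congr 1; omega
  rw [Function.comp_apply, hsplit, inv_pow, div_mul_eq_div_div, div_self (by positivity), one_div]

/-- **`Pad L ∈ AvgP^O` for every language `L` and every oracle** (the constant answer `false` is a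
vanishing-error heuristic). [cite: AaronsonAmbainis2014, §1 (AvgP)] -/
theorem pad_mem_AvgPRel (O : Oracle) (L : Language Bool) :
    ({z | copyFn (fstP z) = z ∧ fstP z ∈ L} : Language Bool) ∈ AvgPRel O := by
  obtain ⟨M, hM, q, h⟩ := zero_mem_PRel O
  refine ⟨M, hM, q, fun x => (h x).2, ?_⟩
  have hf : (fun x => M.run O (q.eval x.length) x) = fun x => some ((0 : Language Bool).boolIndicator x) :=
    funext fun x => (h x).1
  rw [hf]
  exact squeeze_zero' (Eventually.of_forall fun n => errFraction_nonneg _ _ _)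
    (Eventually.of_forall fun n => errFraction_pad_le L n) tendsto_pad_bound

/-! ## §3 THE PADDING LAW -/

/-- **PADDING LAW at `AvgP`**: `K ⟺ (NP ⊆ P → PP ∩ AvgP ⊆ P)` — the hub residual is invariant under
replacing its lift side «PP ⊆ P» by «every PP language that is easy on average is easy».
Hypothesis-free. [cite: AaronsonAmbainis2014, §1 (AvgP)] -/
theorem collapseLift_iff_avgLift :
    RootDecompSpaceCeiling.CollapseLift ↔
      (Nondeterministic.NP ⊆ Classes.P →
        ∀ L : Language Bool, L ∈ PP → L ∈ AvgPRel Oracle.empty → L ∈ Classes.P) := by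
  refine ⟨fun hK hc L hL _ => hK hc hL, fun h hc L hL => ?_⟩
  have hpad := h hc _ (pad_mem_PP hL) (pad_mem_AvgPRel Oracle.empty L)
  rw [← preimage_copyFn_pad L]
  exact preimage_mem_P hpad copyFn_mem_FP

/-- The CATCH side is a consequence of `K`: `K → (NP ⊆ P → PP ⊆ AvgP)`. [cite: AaronsonAmbainis2014, §1 (AvgP)] -/
theorem avgCatch_of_collapseLift (hK : RootDecompSpaceCeiling.CollapseLift)
    (hc : Nondeterministic.NP ⊆ Classes.P) : PP ⊆ AvgPRel Oracle.empty := fun _ hL =>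
  PRel_subset_AvgPRel Oracle.empty (P_subset_PRel_holds Oracle.empty (hK hc hL))

/-- Hence the exact cell `K ⟺ AvgCatch ∧ AvgLift` degenerates: `AvgLift ⟺ K` and `K → AvgCatch`.
[cite: AaronsonAmbainis2014, §1 (AvgP)] -/
theorem collapseLift_iff_avgCell :
    RootDecompSpaceCeiling.CollapseLift ↔
      (Nondeterministic.NP ⊆ Classes.P → PP ⊆ AvgPRel Oracle.empty) ∧
      (Nondeterministic.NP ⊆ Classes.P →
        ∀ L : Language Bool, L ∈ PP → L ∈ AvgPRel Oracle.empty → L ∈ Classes.P) :=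
  ⟨fun hK => ⟨avgCatch_of_collapseLift hK, collapseLift_iff_avgLift.1 hK⟩,
    fun h => collapseLift_iff_avgLift.2 h.2⟩

/-- **RELATIVIZED PADDING LAW**: for every oracle, `K^O ⟺ (NP^O ⊆ P^O → PP^O ∩ AvgP^O ⊆ P^O)` — so the
average-case lift piece inherits `K`'s relativized certificate (`KRelCertificate`, stmt-PneNP-32376)
verbatim. [cite: BakerGillSolovay1975, Thm. 1] -/
theorem kRel_iff_avgLiftRel (O : Oracle) :
    (NPRel O ⊆ PRel O → PPRel O ⊆ PRel O) ↔
      (NPRel O ⊆ PRel O → ∀ L : Language Bool, L ∈ PPRel O → L ∈ AvgPRel O → L ∈ PRel O) := by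
  refine ⟨fun hK hc L hL _ => hK hc hL, fun h hc L hL => ?_⟩
  have hpad := h hc _ (pad_mem_PPRel hL) (pad_mem_AvgPRel O L)
  rw [← preimage_copyFn_pad L]
  exact preimage_mem_PRel hpad copyFn_mem_FP

/-! ### budgeted form: every DENSE error budget -/

/-- `Pad L` is within error budget `δ` of the empty language for every dense `δ`.
[cite: BogdanovTrevisan2006, Def. 2.13] -/
theorem pad_heur_of_dense {δ : ℕ → ℝ} (hδ : ∃ m₀ : ℕ, ∀ m ≥ m₀, (2 : ℝ) ^ ((m - 2) / 3) ≤ δ m * 2 ^ m)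
    (L : Language Bool) : ∃ L' ∈ Classes.P, ∃ n₀ : ℕ, ∀ n ≥ n₀,
      errFraction ({z | copyFn (fstP z) = z ∧ fstP z ∈ L} : Language Bool)
        (fun x => some (L'.boolIndicator x)) n ≤ δ n := by
  obtain ⟨m₀, hm⟩ := hδ
  refine ⟨0, zero_mem_P, m₀, fun n hn => (errFraction_pad_le L n).trans ?_⟩
  rw [div_le_iff₀ (by positivity)]
  exact hm n hn

/-- **PADDING LAW, budgeted**: for every dense error budget `δ`,
`K ⟺ (NP ⊆ P → PP ∩ Heur_δ P ⊆ P)` where `L ∈ Heur_δ P` iff some `L' ∈ P` has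
`errFraction L [· ∈ L'] n ≤ δ n` for all large `n`. [cite: BogdanovTrevisan2006, Def. 2.13] -/
theorem collapseLift_iff_heurLift {δ : ℕ → ℝ}
    (hδ : ∃ m₀ : ℕ, ∀ m ≥ m₀, (2 : ℝ) ^ ((m - 2) / 3) ≤ δ m * 2 ^ m) :
    RootDecompSpaceCeiling.CollapseLift ↔
      (Nondeterministic.NP ⊆ Classes.P → ∀ L : Language Bool, L ∈ PP →
        (∃ L' ∈ Classes.P, ∃ n₀ : ℕ, ∀ n ≥ n₀, errFraction L (fun x => some (L'.boolIndicator x)) n ≤ δ n) →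
          L ∈ Classes.P) := by
  refine ⟨fun hK hc L hL _ => hK hc hL, fun h hc L hL => ?_⟩
  have hpad := h hc _ (pad_mem_PP hL) (pad_heur_of_dense hδ L)
  rw [← preimage_copyFn_pad L]
  exact preimage_mem_P hpad copyFn_mem_FP

/-- DENSITY INSTANCES: the exponentially small budget `2^-(m/2)` is dense … [folklore] -/
theorem dense_exp : ∃ m₀ : ℕ, ∀ m ≥ m₀, (2 : ℝ) ^ ((m - 2) / 3) ≤ ((2 : ℝ) ^ (m / 2))⁻¹ * 2 ^ m := by
  refine ⟨0, fun m _ => ?_⟩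
  have hsplit : (2 : ℝ) ^ m = 2 ^ (m / 2) * 2 ^ (m - m / 2) := by
    rw [← pow_add]; congr 1; omega
  rw [hsplit, ← mul_assoc, inv_mul_cancel₀ (by positivity), one_mul]
  exact pow_le_pow_right₀ (by norm_num) (by omega)

/-- … every constant positive budget is dense … [folklore] -/
theorem dense_const {ε : ℝ} (hε : 0 < ε) : ∃ m₀ : ℕ, ∀ m ≥ m₀, (2 : ℝ) ^ ((m - 2) / 3) ≤ ε * 2 ^ m := by
  obtain ⟨N, hN⟩ := exists_nat_gt ε⁻¹
  have hN2 : ε⁻¹ < (2 : ℝ) ^ N := hN.trans (by exact_mod_cast Nat.lt_two_pow_self)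
  have hεN : 1 ≤ ε * 2 ^ N := by
    have := (inv_lt_iff_one_lt_mul₀ hε).1 hN2
    linarith
  refine ⟨3 * N, fun m hm => ?_⟩
  have hsplit : (2 : ℝ) ^ m = 2 ^ (m - (m - 2) / 3) * 2 ^ ((m - 2) / 3) := by
    rw [← pow_add]; congr 1; omega
  rw [hsplit, ← mul_assoc]
  have hk : (2 : ℝ) ^ N ≤ 2 ^ (m - (m - 2) / 3) := pow_le_pow_right₀ (by norm_num) (by omega)
  have h1 : (1 : ℝ) ≤ ε * 2 ^ (m - (m - 2) / 3) := hεN.trans (mul_le_mul_of_nonneg_left hk hε.le)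
  calc (2 : ℝ) ^ ((m - 2) / 3) = 1 * 2 ^ ((m - 2) / 3) := (one_mul _).symm
    _ ≤ ε * 2 ^ (m - (m - 2) / 3) * 2 ^ ((m - 2) / 3) := mul_le_mul_of_nonneg_right h1 (by positivity)

/-- … and every inverse polynomial `1/(m+1)^c` is dense (polynomials lose to `2^(m/2)`). [folklore] -/
theorem dense_inv_poly (c : ℕ) :
    ∃ m₀ : ℕ, ∀ m ≥ m₀, (2 : ℝ) ^ ((m - 2) / 3) ≤ (((m : ℝ) + 1) ^ c)⁻¹ * 2 ^ m := by
  -- Step 1: `(m+1)^c ≤ 2^(m/2)` eventually.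
  have ht : Tendsto (fun n : ℕ => (n : ℝ) ^ c * (2⁻¹ : ℝ) ^ n) atTop (nhds 0) :=
    tendsto_pow_const_mul_const_pow_of_abs_lt_one c (by rw [abs_of_pos (by norm_num)]; norm_num)
  have hev := (tendsto_order.1 ht).2 ((2⁻¹ : ℝ) ^ (c + 1)) (by positivity)
  obtain ⟨N, hN⟩ := eventually_atTop.1 hev
  have hpoly : ∀ m ≥ 2 * N, ((m : ℝ) + 1) ^ c ≤ (2 : ℝ) ^ (m / 2) := by
    intro m hm
    have hA := hN (m / 2 + 1) (by omega)
    rw [inv_pow, inv_pow, ← div_eq_mul_inv, div_lt_iff₀ (by positivity)] at hA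
    have hB : ((m / 2 + 1 : ℕ) : ℝ) ^ c * 2 ^ c * 2 < 2 ^ (m / 2) * 2 := by
      have h1 := mul_lt_mul_of_pos_right hA (show (0 : ℝ) < 2 ^ (c + 1) by positivity)
      rw [mul_comm ((2 : ℝ) ^ (c + 1))⁻¹ _, mul_assoc, inv_mul_cancel₀ (by positivity), mul_one] at h1
      have e3 : ((m / 2 + 1 : ℕ) : ℝ) ^ c * 2 ^ (c + 1) = ((m / 2 + 1 : ℕ) : ℝ) ^ c * 2 ^ c * 2 := by ring
      have e4 : (2 : ℝ) ^ (m / 2 + 1) = 2 ^ (m / 2) * 2 := by ring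
      rw [e3, e4] at h1
      exact h1
    have hm1 : (m : ℝ) + 1 ≤ 2 * ((m / 2 + 1 : ℕ) : ℝ) := by
      have : m + 1 ≤ 2 * (m / 2 + 1) := by omega
      exact_mod_cast this
    calc ((m : ℝ) + 1) ^ c ≤ (2 * ((m / 2 + 1 : ℕ) : ℝ)) ^ c := pow_le_pow_left₀ (by positivity) hm1 c
      _ = ((m / 2 + 1 : ℕ) : ℝ) ^ c * 2 ^ c := by rw [mul_pow]; ring
      _ ≤ 2 ^ (m / 2) := le_of_lt (lt_of_mul_lt_mul_right hB (by norm_num))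
  -- Step 2: compare with the dense budget `2^-(m/2)`.
  obtain ⟨m₁, h₁⟩ := dense_exp
  refine ⟨max m₁ (2 * N), fun m hm => (h₁ m (le_trans (le_max_left _ _) hm)).trans ?_⟩
  refine mul_le_mul_of_nonneg_right ?_ (by positivity)
  exact (inv_le_inv₀ (by positivity) (by positivity)).2 (hpoly m (le_trans (le_max_right _ _) hm))

/-- THE LAW FOR INVERSE-POLYNOMIAL BUDGETS (the headline regime of average-case complexity), as one
statement over the route declaration. [cite: BogdanovTrevisan2006, Def. 2.13] -/
theorem collapseLift_iff_heurLift_inv_poly (c : ℕ) :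
    RootDecompSpaceCeiling.CollapseLift ↔
      (Nondeterministic.NP ⊆ Classes.P → ∀ L : Language Bool, L ∈ PP →
        (∃ L' ∈ Classes.P, ∃ n₀ : ℕ, ∀ n ≥ n₀,
          errFraction L (fun x => some (L'.boolIndicator x)) n ≤ (((n : ℝ) + 1) ^ c)⁻¹) →
          L ∈ Classes.P) :=
  collapseLift_iff_heurLift (δ := fun n => (((n : ℝ) + 1) ^ c)⁻¹) (dense_inv_poly c)

end Summit.PneNP.PneNP.Theorems.RootDecompHeuristicPaddingPort
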